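import Summits.BirchSwinnertonDyer.BirchSwinnertonDyer.Theses.SignedBaseChange
import Summits.BirchSwinnertonDyer.BirchSwinnertonDyer.Theorems.SignedBaseChangeAnticyclotomicEisensteinDivisibilityOfFactsRefereed
import Summits.BirchSwinnertonDyer.BirchSwinnertonDyer.Theorems.SignedBaseChangeAnticyclotomicEisensteinDivisibilityBdpLowerHalfAllAdditive
import Summits.BirchSwinnertonDyer.BirchSwinnertonDyer.Theorems.SignedBaseChangeAnticyclotomicEisensteinDivisibilityOrdinary
import Summits.BirchSwinnertonDyer.BirchSwinnertonDyer.Theorems.SignedBaseChangeAnticyclotomicEisensteinDivisibilityXAcTorsionOfLongoVigni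
import Summits.BirchSwinnertonDyer.BirchSwinnertonDyer.Theorems.SignedBaseChangeAnticyclotomicEisensteinDivisibilityMinusIsBDPSupersingularBCS
import Summits.BirchSwinnertonDyer.BirchSwinnertonDyer.Theorems.SignedBaseChangeAnticyclotomicEisensteinDivisibilityGreenbergFiveFacts
import Summits.BirchSwinnertonDyer.BirchSwinnertonDyer.Theorems.SignedBaseChangeAnticyclotomicEisensteinDivisibilityBdpLowerHalfSemistable
import Summits.BirchSwinnertonDyer.BirchSwinnertonDyer.Theorems.SignedBaseChangeAnticyclotomicEisensteinDivisibilityS1OfSignedEisensteinMult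
import Summits.BirchSwinnertonDyer.BirchSwinnertonDyer.Theorems.SignedBaseChangeAnticyclotomicEisensteinDivisibilityLocalEulerPoincareCorank
import Literature.NumberTheory.IwasawaTheory.Greenberg2006.GlobalEulerPoincareCorankHolds
import Literature.NumberTheory.GaloisCohomology.RestrictedRamificationFiniteCohomologyOfTateEuler
import Literature.NumberTheory.IwasawaTheory.Greenberg2006.CohomologyCofiniteGenerationHolds
import Literature.NumberTheory.IwasawaTheory.Greenberg2016.LocalCohomologyAlmostDivisible
import HarnessLib

/-!
# Crux `AnticyclotomicEisensteinDivisibility` (stmt-BirchSwinnertonDyer-20727, route SignedBaseChange), line `bdpline` v34 —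
# the crux ON THE SUB-CELL `p ∤ h_K` from TWO stubs: the v34 named-facts conjunction (eleven typed facts, conjunct 8 now the
# REFEREED Burungale–Castella–Skinner 2025 comparison instead of the BSTW preprint) and the twice-narrowed research stub
# `stub_signedEisensteinSS_mult`; the two `p ∣ h_K` stubs (a2) and S1∣ are NOT used

Lead bsd-line-sbc-p1 gen 10 (skeleton v34), `--supports stmt-BirchSwinnertonDyer-20727`. THEOREM ONLY (no definition, no named
fact, no `sorry`). POINTWISE COPY of the lead gen 7's `SignedBaseChangeAcDivCoprimeClassNumberMult.
anticyclotomicEisensteinDivisibility_coprime_of_stubs_mult` (p658739) with ONE conjunct of the named-facts hypothesis `hF` exchanged: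
`BurungaleSkinnerTianWan2024.prop627_span_minus_eq_span_bdp_supersingular_PRE` (BSTW arXiv:2409.01350 Prop. 6.27 (i), preprint) ↦
`BurungaleCastellaSkinner2025.proofProp422_span_minus_eq_span_bdp_goodReduction` (IMRN 2025, proof of Prop. 4.2.2 via CGS23 Prop.
1.4.5; typed p669772, flag `BCS-422-comparison-via-CGS`), consumed through `SignedBaseChangeAcDivMinusIsBDPSSBCS.stub_minusIsBDP_ss_of_bcs`
(p670235) instead of p630219; every other line of the proof is unchanged. So `hF` is the v34 text of `stub_namedFactsSS` VERBATIM and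
the skeleton's derived `AnticyclotomicEisensteinDivisibility_coprime_of` (the coprime-class-number severance: the crux with the binder
`¬ p ∣ h_K` from {named facts, Form T} alone) is fed by THIS theorem with no adapter. CONDITIONAL on the two displayed hypotheses;
closes nothing by itself; no summit statement / BSD is proved by this file.

References: [BurungaleCastellaSkinner2025] IMRN 2025, Prop. 4.2.2 and its proof; [CastellaGrossiSkinner2025] Prop. 2.4.5; the
references of p658739 (Longo–Vigni 2019 Thm. 1.4; Castella–Wan 2024 Thm. 6.8; Yan–Zhu 2026 Thms. 3.3/4.2/4.7; Greenberg 2016 Prop.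
4.1.1; Milne ADT I Thm. 5.1; Harari Thm. 17.13 (a); Bertolini–Longo–Venerucci 2026 Thm. A; Castella–Hsu–Kundu–Lee–Liu 2025 Thm. 7.1).
-/

-- `Summit.BirchSwinnertonDyer.BirchSwinnertonDyer.…`: summit and sub-problem share a name (D-0017 layout).
set_option linter.dupNamespace false
set_option autoImplicit false

noncomputable section

open scoped Classical

namespace Summit.BirchSwinnertonDyer.BirchSwinnertonDyer.Theorems.SignedBaseChangeAcDivCoprimeClassNumberMultBCS

open Summit.BirchSwinnertonDyer.BirchSwinnertonDyer.Theses.SignedBaseChange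
open Literature.NumberTheory.EllipticCurves
open Summit.BirchSwinnertonDyer.BirchSwinnertonDyer.Theorems

/-- **The crux `AnticyclotomicEisensteinDivisibility` with the extra binder `¬ p ∣ h_K`, from the two stubs of skeleton
`bdpline` v34 (pointwise copy of p658739 with conjunct 8 := the refereed BCS25 comparison): `stub_namedFactsSS` (`hF`, the v34 text
VERBATIM: eleven typed named facts, Greenberg tuple = (Gr16 4.1.1 ∧ ∀K Tate global Euler–Poincaré characteristic ∧ ∀K Poitou–Tate
17.13 (a)), conjunct 8 = `BurungaleCastellaSkinner2025.proofProp422_span_minus_eq_span_bdp_goodReduction`, the Castella–Hsu–Kundu–Lee–Liu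
conjunct LAST) and the TWICE-NARROWED
Form T `stub_signedEisensteinSS_mult` (`hT`, verbatim: the v32 text of `stub_signedEisensteinSS_live` with the binder
`¬ (∀ ℓ prime, ℓ ∣ N → ℓ² ∣ N)` after the binder `¬ (Squarefree N ∧ E[p] ramified at every q ∣ N)`).**
The registered composition (p633742) exactly as in p642307/p650754, with the Greenberg block rebuilt from the conjuncts (Greenberg 2016
Prop. 4.2.2 and Greenberg 2006 Prop. 4.2 by their `_holds` theorems, NSW (8.3.20) and Prop. 4.1 from the Tate / Poitou–Tate conjuncts,
Prop. 3.2 from NSW) and S1 on the coprime cell by the THREE-way split: all-additive ⟶ the BLV conjunct (p637797); `N` square-free with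
`E[p]` ramified at every `q ∣ N` ⟶ the CHKLL conjunct (p649308); otherwise ⟶ the twice-narrowed Form T
(`SignedBaseChangeAcDivS1OfSignedEisensteinMult.bdpLowerHalfRatSS_mult_of_signedEisensteinMult`, fed the branch's `hsq`).
CONDITIONAL on the two displayed hypotheses; the registered crux (every `K`) is not proved here; BSD is not advanced.
[cite: LongoVigni2019, Thm. 1.4] [cite: CastellaWan2023, Thm. 6.8 and its proof (MS pp. 29–31)]
[cite: YanZhu2024MainConjNonCM, Thms. 3.3, 4.2 (2), 4.7] [cite: BurungaleCastellaSkinner2025, Prop. 4.2.2]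
[cite: BurungaleCastellaSkinner2025, Prop. 4.2.2 and its proof (§4.2, p. 9)] [cite: Greenberg2016Selmer, Prop. 4.1.1]
[cite: BertoliniLongoVenerucci2026, Thm. A with Hyp. 1.1] [cite: CastellaEtAl2025, Thm. 7.1 and Cor. 7.2]
[cite: MilneADT2006, I Thm. 5.1] [cite: Harari2020, Thm. 17.13 (a)] -/
theorem anticyclotomicEisensteinDivisibility_coprime_of_stubs_mult_bcs
    (hF : (Literature.NumberTheory.EllipticCurves.YanZhu2026.thm42_XGr₂_isTorsion_charIdeal_le_greenbergAnyRoot ∧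
      Literature.NumberTheory.EllipticCurves.YanZhu2026.thm47_ord_localised_iff_greenbergAnyRoot_localised_guarded ∧
      Literature.NumberTheory.EllipticCurves.YanZhu2026.thm33_exists_isHidaRankinLFunction) ∧
      (∀ (W : WeierstrassCurve ℚ) [W.IsGloballyMinimal] (K : Type) [Field K] [NumberField K] (p : ℕ) [Fact p.Prime]
      (κ : Literature.NumberTheory.EllipticCurves.ZpExtension K p) (𝔭 𝔭' : IsDedekindDomain.HeightOneSpectrum (NumberField.RingOfIntegers K)),
      Literature.NumberTheory.EllipticCurves.AcSigned.longoVigni2019_thm14_signedSelmerDual_rank_one W K p κ 𝔭 𝔭') ∧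
      (∀ (N : ℕ) [NeZero N] (W : WeierstrassCurve ℚ) [W.IsGloballyMinimal] (K : Type) [Field K] [NumberField K] (p : ℕ) [Fact p.Prime]
      (κ : Literature.NumberTheory.EllipticCurves.ZpExtension K p) (𝔭 𝔭' : IsDedekindDomain.HeightOneSpectrum (NumberField.RingOfIntegers K)),
      Literature.NumberTheory.EllipticCurves.AcSigned.castellaWan2024_proofThm68_transferInputs N W K p κ 𝔭 𝔭') ∧
      (∀ (N : ℕ) [NeZero N] (W : WeierstrassCurve ℚ) [W.IsGloballyMinimal] (K : Type) [Field K] [NumberField K] (p : ℕ) [Fact p.Prime]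
      (κ : Literature.NumberTheory.EllipticCurves.ZpExtension K p) (𝔭 𝔭' : IsDedekindDomain.HeightOneSpectrum (NumberField.RingOfIntegers K)),
      Literature.NumberTheory.EllipticCurves.AcSigned.castellaWan2024_lemma67_finrank_torsionCharIdeal N W K p κ 𝔭 𝔭') ∧
      (∀ (N : ℕ) [NeZero N] (W : WeierstrassCurve ℚ) [W.IsGloballyMinimal] (K : Type) [Field K] [NumberField K] (p : ℕ) [Fact p.Prime]
      (κ : Literature.NumberTheory.EllipticCurves.ZpExtension K p) (𝔭 𝔭' : IsDedekindDomain.HeightOneSpectrum (NumberField.RingOfIntegers K)),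
      Literature.NumberTheory.EllipticCurves.AcSigned.castellaWan2024_proofThm68_selmerRel_le_selmerSgn N W K p κ 𝔭 𝔭') ∧
      Literature.NumberTheory.EllipticCurves.BertoliniLongoVenerucci2026.thmA_castellaWan_thm68_exists_isCWBDPLFunction_charIdeal_map_le_rat ∧
      (Literature.NumberTheory.IwasawaTheory.Greenberg2016.prop411_selmer_isAlmostDivisible ∧
      (∀ (K : Type) [Field K] [NumberField K], Literature.NumberTheory.GaloisCohomology.tateGlobalEulerPoincareCharacteristic K) ∧
      (∀ (K : Type) [Field K] [NumberField K], Literature.NumberTheory.GaloisCohomology.poitouTate_restricted_three_le K)) ∧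
      Literature.NumberTheory.EllipticCurves.BurungaleCastellaSkinner2025.proofProp422_span_minus_eq_span_bdp_goodReduction ∧
      Literature.NumberTheory.EllipticCurves.BurungaleCastellaSkinner2025.prop422_exists_isBDPLFunction_mu_eq_zero ∧
      Literature.NumberTheory.EllipticCurves.CastellaHsuKunduLeeLiu2025.thm71_cor72_exists_isCWBDPLFunction_charIdeal_map_le_rat)
    (hT : SignedTwoVariableInputs → Literature.NumberTheory.EllipticCurves.ModularForms.nonempty_modularParametrizationData → ∀ (W : WeierstrassCurve ℚ) [W.IsElliptic] [W.IsGloballyMinimal] (p : ℕ) [Fact p.Prime], 5 ≤ p → W.HasGoodReductionAtPrime p → W.frobeniusTrace p = 0 → Literature.NumberTheory.EllipticCurves.Rank1Residual.Surj W p → ∀ (K : Type) [Field K] [NumberField K] (ι : PadicAlgCl p ≃+* ℂ) (v vbar : IsDedekindDomain.HeightOneSpectrum (NumberField.RingOfIntegers K)) (κ₁ κ₂ : Literature.NumberTheory.EllipticCurves.ZpExtension K p) (γ₁ γ₂ : Field.absoluteGaloisGroup K) [Fact (Literature.NumberTheory.EllipticCurves.ZpExtension.IsTopGeneratorPair κ₁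 κ₂ γ₁ γ₂)] [NeZero (NumberField.discr K).natAbs] (N : ℕ) [NeZero N] (f : CuspForm (CongruenceSubgroup.Gamma0 N) 2), Literature.NumberTheory.EllipticCurves.ModularForms.IsNewformOf W f → (N : ℤ) = W.conductorNorm ℤ → Literature.NumberTheory.EllipticCurves.IsImaginaryQuadratic K → ¬ p ∣ NumberField.classNumber K → ¬ (Squarefree N ∧ ∀ q : ℕ, q.Prime → q ∣ N → ∃ v' : IsDedekindDomain.HeightOneSpectrum (NumberField.RingOfIntegers ℚ), ((q : ℕ) : NumberField.RingOfIntegers ℚ) ∈ v'.asIdeal ∧ ∃ 𝔓 ∈ v'.primesAbove, ∃ σ ∈ 𝔓.inertia (Field.absoluteGaloisGroup ℚ), ∃ P : W.geomTorsion (p : ℤ), σ • P ≠ P) → ¬ (∀ ℓ : ℕ, ℓ.Prime → ℓ ∣ N → ℓ ^ 2 ∣ N) → ((Ideal.span {(p : ℤ)}).primesOver (NumberField.RingOfIntegers K)).ncard = 2 → ((p : ℕ) : NumberField.RingOfIntegers K) ∈ v.asIdeal → ((p : ℕ) : NumberField.RingOfIntegers K) ∈ vbar.asIdeal → vbar ≠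 v → (∀ (w : NumberField.InfinitePlace K) (k : NumberField.RingOfIntegers K), k ∈ v.asIdeal ↔ ‖ι.symm (w.embedding (k : K))‖ < 1) → IsCoprime (N : ℤ) (NumberField.discr K) → (∀ ℓ : ℕ, ℓ.Prime → ℓ ∣ N → ((Ideal.span {(ℓ : ℤ)}).primesOver (NumberField.RingOfIntegers K)).ncard = 2) → Odd (NumberField.discr K) → NumberField.discr K ≠ -3 → κ₁.IsCyclotomic → κ₂.IsAnticyclotomic → ∀ (h𝔭 : AcSigned.IsNonsplitIn κ₂ v) (γ𝔭 : Field.absoluteGaloisGroup (v.adicCompletion K)) (hγ𝔭 : κ₂ (resGalOfEmb (closureEmb (K := K) (v.adicCompletion K)) γ𝔭) = κ₂ γ₂) (hne : v ≠ vbar) (hvp : ((p : ℕ) : NumberField.RingOfIntegers K) ∈ v.asIdeal) (ΩK : ℂ) (Ωp : (unrIntegers p)ˣ) (L : UnrSeries p) (z : AcSigned.selmerLambdaAdic (W.baseChange K) p κ₂ γ₂ (fun _ ↦ .sgn 1)), ΩK ≠ 0 → CastellaWan2024.IsCWBDPLFunction ι v κ₂ γ₂ f (NumberField.discr K) ΩK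 ((Ωp : unrIntegers p) : PadicComplex p) L → AcSigned.TransferInputs (W.baseChange K) p κ₂ γ₂ (YanZhu2026.isTopGenerator_of_pair (κ₁ := κ₁) (γ₁ := γ₁) : κ₂.IsTopGenerator γ₂) v h𝔭 γ𝔭 hγ𝔭 vbar hne hvp 1 z L → ∃ k : ℕ, Ideal.span {((p : ℕ) : IwasawaAlgebra p) ^ k} * AcSigned.X.torsionCharIdeal (W.baseChange K) p κ₂ ∅ (fun _ ↦ .sgn 1) (YanZhu2026.isTopGenerator_of_pair (κ₁ := κ₁) (γ₁ := γ₁) : κ₂.IsTopGenerator γ₂) ≤ (AcSigned.signedHeegnerCharIdeal (YanZhu2026.isTopGenerator_of_pair (κ₁ := κ₁) (γ₁ := γ₁) : κ₂.IsTopGenerator γ₂) 1 z).map (IwasawaAlgebra.invol p) ^ 2) :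
    SignedTwoVariableInputs → Literature.NumberTheory.EllipticCurves.ModularForms.nonempty_modularParametrizationData → ∀ (W : WeierstrassCurve ℚ) [W.IsElliptic] [W.IsGloballyMinimal] (p : ℕ) [Fact p.Prime], 5 ≤ p → W.HasGoodReductionAtPrime p → Literature.NumberTheory.EllipticCurves.Rank1Residual.Surj W p → ∀ (K : Type) [Field K] [NumberField K] (ι : PadicAlgCl p ≃+* ℂ) (v vbar : IsDedekindDomain.HeightOneSpectrum (NumberField.RingOfIntegers K)) (κ₁ κ₂ : Literature.NumberTheory.EllipticCurves.ZpExtension K p) (γ₁ γ₂ : Field.absoluteGaloisGroup K) [Fact (Literature.NumberTheory.EllipticCurves.ZpExtension.IsTopGeneratorPair κ₁ κ₂ γ₁ γ₂)] [NeZero (NumberField.discr K).natAbs] (N : ℕ) [NeZero N] (f : CuspForm (CongruenceSubgroup.Gamma0 N) 2), Literature.NumberTheory.EllipticCurves.ModularForms.IsNewformOf W f → (N : ℤ) = W.conductorNorm ℤ → Literature.NumberTheory.EllipticCurves.IsImaginaryQuadratic K → ((Ideal.span {(p : ℤ)}).primesOver (NumberField.RingOfIntegers K)).ncard = 2 → ((p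 : ℕ) : NumberField.RingOfIntegers K) ∈ v.asIdeal → ((p : ℕ) : NumberField.RingOfIntegers K) ∈ vbar.asIdeal → vbar ≠ v → (∀ (w : NumberField.InfinitePlace K) (k : NumberField.RingOfIntegers K), k ∈ v.asIdeal ↔ ‖ι.symm (w.embedding (k : K))‖ < 1) → IsCoprime (N : ℤ) (NumberField.discr K) → (∀ ℓ : ℕ, ℓ.Prime → ℓ ∣ N → ((Ideal.span {(ℓ : ℤ)}).primesOver (NumberField.RingOfIntegers K)).ncard = 2) → Odd (NumberField.discr K) → NumberField.discr K ≠ -3 → κ₁.IsCyclotomic → κ₂.IsAnticyclotomic → ¬ p ∣ NumberField.classNumber K → ∀ (Ω δ : ℂ) (Ωp : (Literature.NumberTheory.EllipticCurves.unrIntegers p)ˣ) (LK G : PowerSeries (PowerSeries (PadicComplexInt p))), Ω ≠ 0 → (δ ^ 2 = (NumberField.discr K : ℂ) ∨ δ ^ 2 = -(NumberField.discr K : ℂ)) → Literature.NumberTheory.EllipticCurves.IsKatzMeasure₂ ι v vbar ∅ κ₁ κ₂ γ₁⁻¹ γ₂⁻¹ 1 Ω δ ((Ωp : Literature.NumberTheory.EllipticCurves.unrIntegers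 p) : PadicComplex p) LK → Literature.NumberTheory.EllipticCurves.IsGreenbergLFunctionAnyRoot₂ ι v vbar κ₁ κ₂ γ₁⁻¹ γ₂⁻¹ f (NumberField.discr K).natAbs (NumberField.classNumber K) LK G → ∀ J : ℤ_[p] →+* PadicComplexInt p, (∀ x : ℤ_[p], ((J x : PadicComplexInt p) : PadicComplex p) = ((x : ℚ_[p]) : PadicComplex p)) → ((WeierstrassCurve.XGr₂.charIdeal (W.baseChange K) p κ₁ κ₂ vbar γ₁ γ₂).map (Literature.NumberTheory.EllipticCurves.IwasawaAlgebra₂.toUnr₂ p J)).map (PowerSeries.constantCoeff (R := PowerSeries (PadicComplexInt p))) ≤ Ideal.span {Literature.NumberTheory.EllipticCurves.UnrSeries₂.minus G} := by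
  -- the named facts, projected
  obtain ⟨⟨h42, h47, h33⟩, hLV, hCW, hL67, hRel, hBLV, ⟨hG1, hTate, hPTa⟩, hbcs, h422e, hCHKLL⟩ := hF
  -- v32: NSW (8.3.20) for every number field from Tate's global Euler–Poincaré characteristic and Poitou–Tate 17.13 (a) (w2 g9, p654899)
  have hPT : ∀ (K : Type) [Field K] [NumberField K], Literature.NumberTheory.GaloisCohomology.finite_restrictedCohomology K :=
    Literature.NumberTheory.GaloisCohomology.forall_finite_restrictedCohomology_of_tate_of_poitouTate_three_le hTate hPTa
  -- v31: Greenberg 2006 Prop. 4.1 from Tate + Poitou–Tate 17.13 (a) + NSW (w8 g0, p652909); Prop. 4.2 unconditionally (w2 g8, p653816)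
  have hG3 : Literature.NumberTheory.IwasawaTheory.Greenberg2006.prop41_globalEulerPoincareCorank :=
    Literature.NumberTheory.IwasawaTheory.Greenberg2006.prop41_of_tateGlobalEulerPoincareCharacteristic hTate hPTa hPT
  have hG4 : Literature.NumberTheory.IwasawaTheory.Greenberg2006.prop42_localEulerPoincareCorank :=
    Literature.NumberTheory.IwasawaTheory.Greenberg2006.prop42_localEulerPoincareCorank_holds
  -- v29: Greenberg 2016 Prop. 4.2.2 is a tree THEOREM (width seat w6, p649329)
  have hG2 : Literature.NumberTheory.IwasawaTheory.Greenberg2016.prop422_localCohomology_isAlmostDivisible :=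
    Literature.NumberTheory.IwasawaTheory.Greenberg2016.prop422_localCohomology_isAlmostDivisible_holds
  -- v28–v32: Greenberg 2006 Prop. 3.2 from NSW (8.3.20) = Harari Cor. 17.17 (itself derived above)
  have hG5 : Literature.NumberTheory.IwasawaTheory.Greenberg2006.prop32_cohomology_isCofinitelyGenerated :=
    Literature.NumberTheory.IwasawaTheory.Greenberg2006.prop32_cohomology_isCofinitelyGenerated_of_finite_restrictedCohomology hPT
  have hGr := SignedBaseChangeAcDivGreenbergFiveFacts.greenberg2016FactsSS_of_five hG1 hG2 hG3 hG4 hG5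
  intro hIn hmodP W _ _ p _ hp hgood hs K _ _ ι v vbar κ₁ κ₂ γ₁ γ₂ _ _ N _ f hf hN hK hsplit hv hvbar hvv hι hcop hHeeg hodd
    hne3 hκ₁ hκ₂ hh Ω δ Ωp LK G hΩ hδ hLK hG J hJ
  by_cases hap : ¬ (p : ℤ) ∣ W.frobeniusTrace p
  · -- ordinary slice: print (stub_ordSlice), no class-number input
    exact SignedBaseChangeAcDivOrdinary.acDivChild_of_goodOrd h42 h47 h33 hIn hmodP W p hp hgood ⟨hgood, hap⟩ hs K ι v vbar κ₁ κ₂ γ₁ γ₂ N f hf hN hK hsplit hv hvbar hvv hι hcop hHeeg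
      hodd hne3 hκ₁ hκ₂ Ω δ Ωp LK G hΩ hδ hLK hG J hJ
  have ha0 : W.frobeniusTrace p = 0 := (W.natCast_dvd_frobeniusTrace_iff_eq_zero p hp hgood).mp (not_not.mp hap)
  have hγ₂ : κ₂.IsTopGenerator γ₂ := YanZhu2026.isTopGenerator_of_pair (κ₁ := κ₁) (γ₁ := γ₁)
  haveI : Fact (κ₂.IsTopGenerator γ₂) := ⟨hγ₂⟩
  -- S2a: finite generation = Nakayama for duals over Λ₂ + finiteness of `unrSelmer₂[𝔪]`
  haveI : (W.baseChange K).IsElliptic := by rw [WeierstrassCurve.baseChange]; infer_instance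
  have hpair : ZpExtension.IsTopGeneratorPair κ₁ κ₂ γ₁ γ₂ := Fact.out
  have hfin := SignedBaseChangeAcDivFinitePiece.stub_finitePieceSS K (W.baseChange K) p κ₁ κ₂ vbar γ₁ γ₂ hpair
  haveI hfg : Module.Finite (IwasawaAlgebra₂ p) ((W.baseChange K).XGr₂ p κ₁ κ₂ vbar γ₁ γ₂) := by
    refine SignedBaseChangeAcDivNakayamaTwoVar.stub_nakayamaDualTwoVar p (unrSelmer₂ κ₁ κ₂ (WeierstrassCurve.geomPrimaryTorsion (W.baseChange K) p) vbar)
      ((W.baseChange K).XGr₂ p κ₁ κ₂ vbar γ₁ γ₂)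
      (conjSel₂ κ₁ κ₂ (WeierstrassCurve.geomPrimaryTorsion (W.baseChange K) p) vbar γ₁ - 1)
      (conjSel₂ κ₁ κ₂ (WeierstrassCurve.geomPrimaryTorsion (W.baseChange K) p) vbar γ₂ - 1)
      (AddMonoidHom.id _) Function.bijective_id (fun x s ↦ ?_) (fun x s ↦ ?_) (fun c x s k hk ↦ ?_)
      (TwoVariableSelmer.isLocNil₂_conjSel₂ (WeierstrassCurve.geomPrimaryTorsion (W.baseChange K) p) vbar hpair
        ((W.baseChange K).exists_pow_smul_geomPrimaryTorsion_eq_zero p) ((W.baseChange K).isOpen_stabilizer_geomPrimaryTorsion' p)) ?_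
    · show ((PowerSeries.X : IwasawaAlgebra₂ p) • x) s = x ((conjSel₂ κ₁ κ₂ (WeierstrassCurve.geomPrimaryTorsion (W.baseChange K) p) vbar γ₁ - 1) s)
      rw [WeierstrassCurve.XGr₂.X_smul_apply, IwasawaDual.End_sub_apply, AddMonoid.End.one_apply]
      exact (AddMonoidHom.map_sub (show unrSelmer₂ κ₁ κ₂ (WeierstrassCurve.geomPrimaryTorsion (W.baseChange K) p) vbar →+
        AddCircle (1 : ℚ) from x) _ _).symm
    · show ((PowerSeries.C (PowerSeries.X : IwasawaAlgebra p) : IwasawaAlgebra₂ p) • x) s = x ((conjSel₂ κ₁ κ₂ (WeierstrassCurve.geomPrimaryTorsion (W.baseChange K) p) vbar γ₂ - 1) s)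
      rw [WeierstrassCurve.XGr₂.CX_smul_apply, IwasawaDual.End_sub_apply, AddMonoid.End.one_apply]
      exact (AddMonoidHom.map_sub (show unrSelmer₂ κ₁ κ₂ (WeierstrassCurve.geomPrimaryTorsion (W.baseChange K) p) vbar →+
        AddCircle (1 : ℚ) from x) _ _).symm
    · show ((PowerSeries.C (PowerSeries.C c : IwasawaAlgebra p) : IwasawaAlgebra₂ p) • x) s = (PadicInt.toZModPow k c).val • x s
      exact WeierstrassCurve.XGr₂.CC_smul_apply (W.baseChange K) p κ₁ κ₂ vbar γ₁ γ₂ c x hk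
    · refine hfin.subset fun s hs ↦ ?_
      obtain ⟨h0, h1, h2⟩ := hs
      rw [IwasawaDual.End_sub_apply, AddMonoid.End.one_apply, sub_eq_zero] at h1 h2
      exact ⟨h0, h1, h2⟩
  -- torsion of `X_Gr₂` from the ONE-variable torsion of `X_ac` on the REFEREED road (a1) — the only consumer of `p ∤ h_K`
  have hA1 := SignedBaseChangeAcDivXAcTorsionOfLongoVigni.xAcTorsionSS_of_longoVigni_castellaWan hLV hCW hIn hmodP W p hp hgood
    ha0 hs K ι v vbar κ₁ κ₂ γ₁ γ₂ N f hf hN hK hsplit hv hvbar hvv hι hcop hHeeg hodd hne3 hκ₁ hκ₂ hh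
  have hV := SignedBaseChangeAcDivOfFacts.inertiaVanishingSS hIn hmodP W p hp hgood ha0 hs K ι v vbar κ₁ κ₂ γ₁ γ₂ N f hf hN
    hK hsplit hv hvbar hvv hι hcop hHeeg hodd hne3 hκ₁ hκ₂
  have htors := SignedBaseChangeAcDivControlTorsion.stub_torsionSS_of_isTorsion_XAc_of_vanishing_of_away
    W p hp hgood ha0 hs K ι v vbar κ₁ κ₂ γ₁ γ₂ N f hf hN hK hsplit hv hvbar hvv hι hcop hHeeg hodd hne3 hκ₁ hκ₂ hA1 hV
    (SignedBaseChangeAcDivAwayDiscrepancy.stub_awayDiscrepancySS hIn hmodP W p hp hgood ha0 hs K ι v vbar κ₁ κ₂ γ₁ γ₂ N f hf hN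
      hK hsplit hv hvbar hvv hι hcop hHeeg hodd hne3 hκ₁ hκ₂ hV)
  obtain ⟨fc, hfc⟩ := SignedBaseChangeAcDivControl.stub_controlSurjSS hIn hmodP W p hp hgood ha0 hs K ι v vbar κ₁ κ₂ γ₁ γ₂ N f hf hN hK hsplit hv hvbar hvv hι hcop hHeeg hodd hne3 hκ₁ hκ₂
  obtain ⟨ΩK₃, Ωp₃, L₃, hΩK₃, hL₃, hcmp⟩ :=
    SignedBaseChangeAcDivMinusIsBDPSSBCS.stub_minusIsBDP_ss_of_bcs hbcs h422e hIn hmodP W p hp hgood ha0 hs K ι v vbar κ₁ κ₂ γ₁ γ₂ N f hf hN hK hsplit hv hvbar hvv hι hcop hHeeg hodd hne3 hκ₁ hκ₂ Ω δ Ωp LK G hΩ hδ hLK hG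
  -- dichotomy on `(T₁) ∈ Supp X_Gr₂`: if so, the specialised ideal is `⊥`
  by_cases h0 : Literature.NumberTheory.EllipticCurves.Module.lengthAt (IwasawaAlgebra₂ p) ((W.baseChange K).XGr₂ p κ₁ κ₂ vbar γ₁ γ₂)
      ⟨Ideal.span {(PowerSeries.X : IwasawaAlgebra₂ p)}, PowerSeries.span_X_isPrime⟩ = 0
  swap
  · rw [show WeierstrassCurve.XGr₂.charIdeal (W.baseChange K) p κ₁ κ₂ vbar γ₁ γ₂ =
        Literature.NumberTheory.EllipticCurves.Module.charIdeal (IwasawaAlgebra₂ p) ((W.baseChange K).XGr₂ p κ₁ κ₂ vbar γ₁ γ₂) from rfl,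
      SignedBaseChangeAcDivSpecialization.S2.map_toUnr₂_map_constantCoeff_eq_bot_of_lengthAt_ne_zero p _ htors h0 J]
    exact bot_le
  -- `(T₁) ∉ Supp X_Gr₂`: a killing element `s` with `s(0) ≠ 0` makes `X_ac` (a quotient of `X_Gr₂/T₁`) `Λ_ac`-torsion
  obtain ⟨s, hsX, hsm⟩ :=
    SignedBaseChangeAcDivSpecialization.LocalLength.exists_notMem_forall_smul_eq_zero_of_lengthAt_eq_zero h0
  have hs0 : PowerSeries.constantCoeff s ≠ 0 := fun h ↦ hsX
    ((SignedBaseChangeAcDivSpecialization.PowerSeriesSpecialization.mem_span_X_iff (A := IwasawaAlgebra p)).mpr h)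
  -- finite exponent of `X_Gr₂[T₁]` from the six Greenberg facts (five typed + §5 A proved)
  have hm := SignedBaseChangeAcDivOfFacts.finiteExponentSS_of_facts hGr hIn hmodP W p hp hgood ha0 hs K ι v vbar κ₁ κ₂ γ₁ γ₂ N f hf hN hK hsplit hv hvbar hvv hι hcop hHeeg hodd hne3 hκ₁ hκ₂ h0
  have hXacTors : Module.IsTorsion (IwasawaAlgebra p) (Castella2018.AcSelmer.XAc (W.baseChange K) p κ₂ vbar ∅ γ₂) := by
    letI : Module (IwasawaAlgebra p) (QuotSMulTop (PowerSeries.X : IwasawaAlgebra₂ p) ((W.baseChange K).XGr₂ p κ₁ κ₂ vbar γ₁ γ₂)) :=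
      Module.compHom _ (PowerSeries.C (R := IwasawaAlgebra p))
    have hq : ∀ q : QuotSMulTop (PowerSeries.X : IwasawaAlgebra₂ p) ((W.baseChange K).XGr₂ p κ₁ κ₂ vbar γ₁ γ₂),
        (PowerSeries.constantCoeff s) • q = 0 := by
      intro q
      show (PowerSeries.C (PowerSeries.constantCoeff s) : IwasawaAlgebra₂ p) • q = 0
      have e : (PowerSeries.C (PowerSeries.constantCoeff s) : IwasawaAlgebra₂ p) =
          (PowerSeries.C (PowerSeries.constantCoeff s) - s) + s := by ring
      obtain ⟨x, rfl⟩ := Submodule.Quotient.mk_surjective _ q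
      rw [e, add_smul,
        SignedBaseChangeAcDivSpecialization.PowerSeriesSpecialization.smul_quotSMulTop_eq_zero
          _ _ (by rw [map_sub, PowerSeries.constantCoeff_C, sub_self]),
        zero_add, ← Submodule.Quotient.mk_smul, hsm, Submodule.Quotient.mk_zero]
    intro y
    obtain ⟨q, rfl⟩ := hfc y
    refine ⟨⟨PowerSeries.constantCoeff s, mem_nonZeroDivisors_of_ne_zero hs0⟩, ?_⟩
    show (PowerSeries.constantCoeff s) • fc q = 0
    rw [← LinearMap.map_smul, hq, map_zero]
  -- μ(G⁻) = 0 from conjunct 1 of the crux's own antecedent (BCS25 Prop. 4.2.2; (irr_K) ⟸ Surj)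
  have hμ : GreenbergVatsal2000.HasUnitContent (UnrSeries₂.minus G) :=
    SignedBaseChangeAcDivRatToInt.hasUnitContent_minus_of_prop422 hIn.1 W hp hgood hs
      K ι v vbar κ₁ κ₂ γ₁ γ₂ hf hN hK hsplit hv hvbar hvv hι hcop hHeeg hodd hne3 hκ₁ hκ₂ hΩ hδ hLK hG
  let J₀ : unrIntegers p →+* PadicComplexInt p := Summit.BirchSwinnertonDyer.Rank1Residual.X11b.R1.unrToCpInt p
  have hJ₀ : ∀ x : unrIntegers p, ((J₀ x : PadicComplexInt p) : PadicComplex p) = (x : PadicComplex p) :=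
    Summit.BirchSwinnertonDyer.Rank1Residual.X11b.R1.coe_unrToCpInt p
  -- RATIONAL specialisation `T₁ ↦ 0`
  obtain ⟨k₂, hk₂⟩ := SignedBaseChangeAcDivSpecialization.S2.xGr₂_specialization_le_rat
    (W.baseChange K) p κ₁ κ₂ vbar γ₁ γ₂ ⟨s, hs0, hsm⟩ hm fc hfc J
  -- S1 on the coprime cell (v29 THREE-way split): all-additive ⟶ the BLV conjunct; square-free `N` with `E[p]` ramified at every
  -- `q ∣ N` ⟶ the CHKLL conjunct (p649308); otherwise ⟶ the TWICE-NARROWED Form T through the lead's transfer (helper C″)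
  obtain ⟨k₁, hk₁⟩ : ∃ k : ℕ, ∀ y ∈ (Castella2018.AcSelmer.XAc.charIdeal (W.baseChange K) p κ₂ vbar ∅ γ₂).map (PowerSeries.map J),
      PowerSeries.C (((p : ℕ) : PadicComplexInt p) ^ k) * y ∈ Ideal.span {PowerSeries.map J₀ L₃} := by
    by_cases hsq : ∀ ℓ : ℕ, ℓ.Prime → ℓ ∣ N → ℓ ^ 2 ∣ N
    · exact SignedBaseChangeAcDivBdpLowerHalfAllAdditive.bdpLowerHalfRatSS_allAdditive_of_BLV hBLV hIn hmodP W p hp hgood ha0 hs K ι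
        v vbar κ₁ κ₂ γ₁ γ₂ N f hf hN hK hsplit hv hvbar hvv hι hcop hHeeg hodd hne3 hκ₁ hκ₂ hh hsq hXacTors ΩK₃ Ωp₃ L₃ hΩK₃ hL₃ J
        hJ J₀ hJ₀
    · by_cases hram : Squarefree N ∧ ∀ q : ℕ, q.Prime → q ∣ N →
          ∃ v' : IsDedekindDomain.HeightOneSpectrum (NumberField.RingOfIntegers ℚ),
            ((q : ℕ) : NumberField.RingOfIntegers ℚ) ∈ v'.asIdeal ∧ ∃ 𝔓 ∈ v'.primesAbove,
              ∃ σ ∈ 𝔓.inertia (Field.absoluteGaloisGroup ℚ), ∃ P : W.geomTorsion (p : ℤ), σ • P ≠ P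
      · exact SignedBaseChangeAcDivBdpLowerHalfSemistable.bdpLowerHalfRatSS_semistable_of_CHKLL hCHKLL hIn hmodP W p hp hgood ha0 hs K
          ι v vbar κ₁ κ₂ γ₁ γ₂ N f hf hN hK hsplit hv hvbar hvv hι hcop hHeeg hodd hne3 hκ₁ hκ₂ hh hram.1 hram.2 hXacTors ΩK₃ Ωp₃ L₃
          hΩK₃ hL₃ J hJ J₀ hJ₀
      · -- v33: Form T is demanded only when some prime divides `N` exactly once (the branch's own `hsq`)
        exact SignedBaseChangeAcDivS1OfSignedEisensteinMult.bdpLowerHalfRatSS_mult_of_signedEisensteinMult hT hLV hCW hL67 hRel hIn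
          hmodP W p hp hgood ha0 hs K ι v vbar κ₁ κ₂ γ₁ γ₂ N f hf hN hK hh hram hsq hsplit hv hvbar hvv hι hcop hHeeg hodd hne3 hκ₁
          hκ₂ hXacTors ΩK₃ Ωp₃ L₃ hΩK₃ hL₃ J hJ J₀ hJ₀
  -- rational S2 + rational S1 + μ(G⁻) = 0 ⟹ the integral inclusion (one-variable cancellation, k = k₁ + k₂)
  refine SignedBaseChangeAcDivRatToInt.le_span_of_forall_C_pow_mul_mem_of_hasUnitContent hμ (k := k₁ + k₂) fun y hy ↦ ?_
  rw [hcmp J₀ hJ₀, pow_add, map_mul, mul_assoc]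
  exact hk₁ _ (hk₂ y hy)

end Summit.BirchSwinnertonDyer.BirchSwinnertonDyer.Theorems.SignedBaseChangeAcDivCoprimeClassNumberMultBCS

end
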